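import Literature.NumberTheory.PAdicHodge.AinfRamifiedWittFormalGroupPoints
import Literature.NumberTheory.PAdicHodge.EisensteinCoeffLubinTate
import Literature.NumberTheory.PAdicHodge.WittFrobeniusCongruence
import Mathlib.RingTheory.WittVector.DiscreteValuationRing
import HarnessLib

/-!
# The Eisenstein coefficient ring `𝒪_D = W(k_F)[ϖ]` is a Lubin–Tate coefficient ring: `IsLTRing ϖ q_F 𝒪_D`

Topic `Literature/NumberTheory/PAdicHodge`; THEOREMS ONLY; the residue-degree-`f` version (datum
`D : EisensteinRootW F p hp` over `W(k_F) = W(k̄)^{Γ_F}`, file `EisensteinRootWittDatum`) of `EisensteinCoeffLubinTate`.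
NOT a transcription: over `W(k_F)` the residue ring `𝒪_D/ϖ` is `k_F = 𝔽_q`, `q = q_F = #k_F = p^f`, not `𝔽_p`, so the
Frobenius congruence `a^q ≡ a (mod ϖ)` holds for `q = q_F` (and fails for `q = p` when `f ≥ 2`); it is obtained from
**`𝕎(σ̄₀) = φ^f` on `W(k̄)`** for an arithmetic Frobenius `σ₀` (`IsAbsArithFrob.residueGal_eq_pow`, coefficientwise; cf. the tree's
`UnramifiedWittFrobenius`), so that
`φ^f = id` on the `Γ_F`-fixed vectors, together with Mathlib's `φ(x) ≡ x^p (mod p)` (`frobenius_sub_pow_mem_span_p`).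

* §0 `W(k_F) = W(k̄)^{Γ_F}`: `p`-torsion-free (`W(k̄)` is a domain), `1 − p z ∈ W(k_F)^×` (`W(k̄)` is a complete DVR with
  residue field `k̄`, Mathlib `WittVector.isUnit_of_coeff_zero_ne_zero`, and inverses of fixed vectors are fixed), and
  **`p ∣ w^{q_F} − w`** for `w ∈ W(k_F)`;
* §1 `𝒪_D = W(k_F)[X]/(f)`: `ϖ^e ∈ p𝒪_D`, `ϖ ∣ p`, `𝒪_D = W(k_F) + ϖ𝒪_D`, **`ϖ ∣ a^{q_F} − a`**, `𝒪_D` is `p`-torsion-free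
  (`isSMulRegular_coeff_natCast`), `1 − p·y` and `1 − ϖ^{m+1}` are units, `ϖ` is (left) regular — the statements are in the forms the
  `W(k_F)`-module structure suggests (smul / regularity / divisibility), not the E1 forms;
* §2 ★ `isLTRing_coeff : IsLTRing ϖ q_F 𝒪_D` and its transport `isLTRing_coeffDisc` to the discrete copy `CoeffDisc D` —
  the hypothesis `hA` of `LubinTateAinfWittTorsionLiftAction` for the special Lubin–Tate series `f = ϖX + X^{q_F}` of `(F, ϖ)`.

No definitions, no named facts, no instances, no `sorry`.

## References
* J. W. S. Cassels, A. Fröhlich (eds.), *Algebraic Number Theory* (1967), Ch. VI (Serre) §3.5 Prop. 5, Remark 2. [CasselsFrohlichANT1967]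
* J.-P. Serre, *Local Fields* (1979), Ch. I §6 Prop. 17–18, Ch. II §5–§6. [SerreLocalFields1979]
* J. Lubin, J. Tate, *Formal complex multiplication in local fields*, Ann. of Math. 81 (1965), §1 Lemma 1. [LubinTate1965]
-/

noncomputable section

open Polynomial IsLocalRing WittVector

namespace Literature.NumberTheory.PAdicHodge

open Literature.NumberTheory.GaloisRepresentations
open Literature.NumberTheory.GaloisRepresentations.IsNonarchimedeanLocalField
open Literature.NumberTheory.GaloisRepresentations.LubinTate
open Field ValuativeRel

variable {F : Type} [Field F] [ValuativeRel F] [TopologicalSpace F] [IsNonarchimedeanLocalField F] [CharZero F]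
  {p : ℕ} [Fact p.Prime]

/-! ## §0 The fixed Witt vectors `W(k_F) = W(k̄)^{Γ_F}` -/

/-- **`φⁿ(x) ≡ x^{pⁿ} (mod p)`** in `𝕎(k)`, `k` a perfect ring of characteristic `p` (iterate of Mathlib's
`φ(x) ≡ x^p (mod p)`). [cite: SerreLocalFields1979, Ch. II §6] -/
theorem iterate_frobenius_sub_pow_mem_span_p {k : Type*} [CommRing k] [CharP k p] [PerfectRing k p]
    (x : WittVector p k) (n : ℕ) :
    (⇑(frobenius : WittVector p k →+* WittVector p k))^[n] x - x ^ p ^ n ∈ Ideal.span {(p : WittVector p k)} := by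
  rw [← Ideal.Quotient.mk_eq_mk_iff_sub_mem]
  induction n with
  | zero => simp
  | succ n ih =>
    rw [Function.iterate_succ_apply', pow_succ, pow_mul, map_pow, ← ih, ← map_pow, Ideal.Quotient.mk_eq_mk_iff_sub_mem]
    exact frobenius_sub_pow_mem_span_p _

omit [CharZero F] in
set_option maxHeartbeats 2000000 in
/-- **`φ^f = id` on `W(k_F) = W(k̄)^{Γ_F}`** (`q_F = p^f`): an arithmetic Frobenius `σ₀ ∈ Γ_F` acts on `k̄` by `y ↦ y^{q_F}`
(`IsAbsArithFrob.residueGal_eq_pow`), hence on `W(k̄)` by `φ^f`, and it fixes `W(k_F)`. [cite: SerreLocalFields1979, Ch. II §5 Thm. 3] -/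
theorem iterate_frobenius_coe_wittFixed [CharP (ResidueField (maxUnramifiedCompletion F)) p] {f : ℕ}
    (hq : residueFieldCard F = p ^ f) (w : wittFixed F p) :
    (⇑(frobenius : WittVector p (ResidueField (maxUnramifiedCompletion F)) →+*
      WittVector p (ResidueField (maxUnramifiedCompletion F))))^[f]
        (w : WittVector p (ResidueField (maxUnramifiedCompletion F))) = w := by
  obtain ⟨σ₀, hσ₀⟩ := exists_isAbsArithFrob_holds (F := F)
  have h : ∀ x : WittVector p (ResidueField (maxUnramifiedCompletion F)), wittGal σ₀ x =
      (⇑(frobenius : WittVector p (ResidueField (maxUnramifiedCompletion F)) →+*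
        WittVector p (ResidueField (maxUnramifiedCompletion F))))^[f] x := by
    intro x
    rw [WittVector.frobenius_eq_map_frobenius]
    refine WittVector.ext fun n => ?_
    rw [coeff_wittGal, IsAbsArithFrob.residueGal_eq_pow hσ₀, hq, ← iterate_frobenius]
    clear hq
    induction f generalizing x with
    | zero => rfl
    | succ f ih =>
      rw [Function.iterate_succ_apply, Function.iterate_succ_apply, ← WittVector.map_coeff, ih]
  rw [← h, wittGal_coe_wittFixed]

omit [CharZero F] in
/-- **`W(k_F)` is `p`-torsion-free** (`W(k̄)` is a domain and `p ≠ 0` there). [cite: SerreLocalFields1979, Ch. II §6 Thm. 7] -/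
theorem wittFixed_eq_zero_of_natCast_mul_eq_zero (hp : valuation F p < 1) {x : wittFixed F p}
    (h : (p : wittFixed F p) * x = 0) : x = 0 := by
  haveI : Fact (¬ IsUnit (p : maxUnramifiedCompletion F)) := ⟨not_isUnit_natCast_completion hp⟩
  haveI : CharP (ResidueField (maxUnramifiedCompletion F)) p := charP_residueField_completion
  have h' : (p : WittVector p (ResidueField (maxUnramifiedCompletion F))) *
      (x : WittVector p (ResidueField (maxUnramifiedCompletion F))) = 0 := by
    have := congrArg ((↑) : wittFixed F p → WittVector p (ResidueField (maxUnramifiedCompletion F))) h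
    simpa using this
  exact Subtype.ext ((mul_eq_zero.1 h').resolve_left (WittVector.p_nonzero p _))

omit [CharZero F] in
set_option maxHeartbeats 2000000 in
/-- **A `Γ_F`-fixed Witt vector that is a unit of `W(k̄)` is a unit of `W(k_F)`** (its inverse is fixed too).
[cite: SerreLocalFields1979, Ch. II §5 Thm. 3] -/
theorem wittFixed_isUnit_of_isUnit_coe (x : wittFixed F p)
    (hx : IsUnit (x : WittVector p (ResidueField (maxUnramifiedCompletion F)))) : IsUnit x := by
  obtain ⟨v, hv⟩ := hx
  have hmem : ((v⁻¹ : (WittVector p (ResidueField (maxUnramifiedCompletion F)))ˣ) :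
      WittVector p (ResidueField (maxUnramifiedCompletion F))) ∈ wittFixed F p := by
    rw [mem_wittFixed_iff]
    intro σ
    have hw : wittGal σ ((v⁻¹ : (WittVector p (ResidueField (maxUnramifiedCompletion F)))ˣ) : WittVector p _) *
        (v : WittVector p (ResidueField (maxUnramifiedCompletion F))) = 1 := by
      calc wittGal σ ((v⁻¹ : (WittVector p (ResidueField (maxUnramifiedCompletion F)))ˣ) : WittVector p _) *
            (v : WittVector p (ResidueField (maxUnramifiedCompletion F)))
          = wittGal σ ((v⁻¹ : (WittVector p (ResidueField (maxUnramifiedCompletion F)))ˣ) : WittVector p _) *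
              wittGal σ (v : WittVector p (ResidueField (maxUnramifiedCompletion F))) := by
            rw [hv, wittGal_coe_wittFixed]
        _ = wittGal σ (((v⁻¹ : (WittVector p (ResidueField (maxUnramifiedCompletion F)))ˣ) : WittVector p _) *
              (v : WittVector p (ResidueField (maxUnramifiedCompletion F)))) := (map_mul _ _ _).symm
        _ = 1 := by rw [Units.inv_mul, map_one]
    exact (Units.inv_eq_of_mul_eq_one_left hw).symm
  refine ⟨⟨x, ⟨_, hmem⟩, Subtype.ext ?_, Subtype.ext ?_⟩, rfl⟩
  · rw [Subring.coe_mul, Subring.coe_one, ← hv, Units.mul_inv]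
  · rw [Subring.coe_mul, Subring.coe_one, ← hv, Units.inv_mul]

omit [CharZero F] in
set_option maxHeartbeats 2000000 in
/-- **`1 − p z ∈ W(k_F)^×`** for every `z ∈ W(k_F)`: `1 − pz` has zeroth Witt component `1`, hence is a unit of the complete
discrete valuation ring `W(k̄)` (Mathlib), and its inverse is again `Γ_F`-fixed. [cite: SerreLocalFields1979, Ch. II §5 Thm. 3, §6 Thm. 7] -/
theorem wittFixed_isUnit_one_sub_natCast_mul (hp : valuation F p < 1) (z : wittFixed F p) :
    IsUnit (1 - (p : wittFixed F p) * z) := by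
  haveI : Fact (¬ IsUnit (p : maxUnramifiedCompletion F)) := ⟨not_isUnit_natCast_completion hp⟩
  haveI : CharP (ResidueField (maxUnramifiedCompletion F)) p := charP_residueField_completion
  haveI : PerfectRing (ResidueField (maxUnramifiedCompletion F)) p := perfectRing_residueField_completion
  apply wittFixed_isUnit_of_isUnit_coe
  rw [AddSubgroupClass.coe_sub, Subring.coe_one, Subring.coe_mul, Subring.coe_natCast]
  apply WittVector.isUnit_of_coeff_zero_ne_zero
  rw [← WittVector.constantCoeff_apply, map_sub, map_one, map_mul, map_natCast, CharP.cast_eq_zero, zero_mul, sub_zero]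
  exact one_ne_zero

omit [CharZero F] in
set_option maxHeartbeats 2000000 in
/-- **`p ∣ w^{q_F} − w` in `W(k_F)`** (`q_F = #k_F = p^f`): an arithmetic Frobenius `σ₀` acts on `W(k̄)` as `φ^f`
(`IsAbsArithFrob.wittGal_eq_iterate_frobenius`) and fixes `w`, so `w = φ^f(w) ≡ w^{p^f} (mod p)`; the quotient
`(w^{q_F} − w)/p ∈ W(k̄)` is again `Γ_F`-fixed because `W(k̄)` is `p`-torsion-free — i.e. `W(k_F)/p = k_F ⊆ 𝔽_{q_F}`.
[cite: SerreLocalFields1979, Ch. II §5 Thm. 3 and §6 Thm. 7] -/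
theorem wittFixed_natCast_dvd_pow_sub (hp : valuation F p < 1) {f : ℕ} (hq : residueFieldCard F = p ^ f)
    (w : wittFixed F p) : (p : wittFixed F p) ∣ w ^ p ^ f - w := by
  haveI : Fact (¬ IsUnit (p : maxUnramifiedCompletion F)) := ⟨not_isUnit_natCast_completion hp⟩
  haveI : CharP (ResidueField (maxUnramifiedCompletion F)) p := charP_residueField_completion
  haveI : PerfectRing (ResidueField (maxUnramifiedCompletion F)) p := perfectRing_residueField_completion
  have hfrob := iterate_frobenius_coe_wittFixed hq w
  have hmem : (w : WittVector p (ResidueField (maxUnramifiedCompletion F))) ^ p ^ f - w ∈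
      Ideal.span {(p : WittVector p (ResidueField (maxUnramifiedCompletion F)))} := by
    have h1 := iterate_frobenius_sub_pow_mem_span_p (w : WittVector p (ResidueField (maxUnramifiedCompletion F))) f
    rw [hfrob, ← Ideal.neg_mem_iff, neg_sub] at h1
    exact h1
  obtain ⟨c, hc⟩ := Ideal.mem_span_singleton'.1 hmem
  have hpfix : ∀ σ : absoluteGaloisGroup F, wittGal σ (p : WittVector p (ResidueField (maxUnramifiedCompletion F))) = p := by
    intro σ
    rw [← Subring.coe_natCast (wittFixed F p) p]
    exact wittGal_coe_wittFixed σ _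
  have hcmem : c ∈ wittFixed F p := by
    rw [mem_wittFixed_iff]
    intro σ
    have h1 : wittGal σ c * p = c * p := by
      conv_lhs => rw [← hpfix σ]
      rw [← map_mul, hc, map_sub, map_pow, wittGal_coe_wittFixed]
    exact mul_right_cancel₀ (WittVector.p_nonzero p _) h1
  refine ⟨⟨c, hcmem⟩, Subtype.ext ?_⟩
  rw [AddSubgroupClass.coe_sub, SubmonoidClass.coe_pow, Subring.coe_mul, Subring.coe_natCast, mul_comm, hc]

namespace EisensteinRootW

variable {hp : valuation F p < 1} (D : EisensteinRootW F p hp)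

/-! ## §1 `ϖ^e ∈ pA`, `p ∈ ϖA`, `A = W(k_F) + ϖA`, `ϖ ∣ a^{q_F} − a`, units, regularity (`A = 𝒪_D`) -/

set_option maxHeartbeats 2000000 in
/-- **`ϖ^e ∈ p𝒪_D`** (`f(ϖ) = 0` and the non-leading coefficients of `f` are divisible by `p`).
[cite: SerreLocalFields1979, Ch. I §6 Prop. 17] -/
theorem root_pow_deg_mem_span_natCast : AdjoinRoot.root D.poly ^ D.deg ∈ Ideal.span {(p : D.Coeff)} := by
  have h := AdjoinRoot.eval₂_root D.poly
  rw [Polynomial.eval₂_eq_sum_range, Finset.sum_range_succ, ← D.deg_def, D.coeff_deg, map_one, one_mul] at h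
  rw [eq_neg_of_add_eq_zero_right h]
  refine (Ideal.neg_mem_iff _).2 (Ideal.sum_mem _ fun i hi => ?_)
  obtain ⟨c, hc⟩ := D.dvd_coeff (Finset.mem_range.1 hi)
  rw [hc, map_mul, map_natCast, mul_assoc]
  exact Ideal.mul_mem_right _ _ (Ideal.mem_span_singleton_self _)

set_option maxHeartbeats 2000000 in
/-- **`ϖ ∣ p` in `𝒪_D`**: the constant coefficient `c₀ = p·u` of `f` equals `−ϖ·((f − c₀)/X)(ϖ)`.
[cite: SerreLocalFields1979, Ch. I §6 Prop. 17] -/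
theorem root_dvd_natCast : AdjoinRoot.root D.poly ∣ (p : D.Coeff) := by
  have hX : AdjoinRoot.root D.poly ∣ AdjoinRoot.of D.poly (D.poly.coeff 0) := by
    have h := map_dvd (AdjoinRoot.mk D.poly) (Polynomial.X_dvd_sub_C (p := D.poly))
    rw [AdjoinRoot.mk_X, map_sub, AdjoinRoot.mk_self, AdjoinRoot.mk_C, zero_sub, dvd_neg] at h
    exact h
  obtain ⟨u, hu⟩ := D.exists_coeff_zero_eq_mul_unit
  have h4 : (p : D.Coeff) = AdjoinRoot.of D.poly (D.poly.coeff 0) * AdjoinRoot.of D.poly ((u⁻¹ : (wittFixed F p)ˣ) : wittFixed F p) := by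
    rw [hu, map_mul, map_natCast, mul_assoc, ← map_mul, Units.mul_inv, map_one, mul_one]
  rw [h4]
  exact Dvd.dvd.mul_right hX _

set_option maxHeartbeats 2000000 in
/-- **`𝒪_D = W(k_F) + ϖ𝒪_D`**: every element is congruent to an element of `W(k_F)` modulo `ϖ`.
[cite: SerreLocalFields1979, Ch. I §6 Prop. 18] -/
theorem exists_sub_of_mem_span_root (a : D.Coeff) :
    ∃ w : wittFixed F p, a - AdjoinRoot.of D.poly w ∈ Ideal.span {AdjoinRoot.root D.poly} := by
  obtain ⟨h, rfl⟩ := AdjoinRoot.mk_surjective a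
  refine ⟨h.coeff 0, Ideal.mem_span_singleton.2 ?_⟩
  have hd := map_dvd (AdjoinRoot.mk D.poly) (Polynomial.X_dvd_sub_C (p := h))
  rw [AdjoinRoot.mk_X, map_sub, AdjoinRoot.mk_C] at hd
  exact hd

set_option maxHeartbeats 2000000 in
/-- **`ϖ ∣ a^{q_F} − a`** for all `a ∈ 𝒪_D` (`a ≡ w ∈ W(k_F) (mod ϖ)`, `p ∣ w^{q_F} − w` and `p ∈ ϖ𝒪_D`): the residue ring
`𝒪_D/ϖ = k_F` has `q_F` elements. [cite: CasselsFrohlichANT1967, Ch. VI §3.5 Remark 2] -/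
theorem root_dvd_pow_sub {f : ℕ} (hq : residueFieldCard F = p ^ f) (a : D.Coeff) :
    AdjoinRoot.root D.poly ∣ a ^ p ^ f - a := by
  obtain ⟨w, hw⟩ := D.exists_sub_of_mem_span_root a
  have h1 : AdjoinRoot.root D.poly ∣ a - AdjoinRoot.of D.poly w := Ideal.mem_span_singleton.1 hw
  have h2 : AdjoinRoot.root D.poly ∣ a ^ p ^ f - AdjoinRoot.of D.poly w ^ p ^ f :=
    dvd_trans h1 (sub_dvd_pow_sub_pow _ _ _)
  obtain ⟨c, hc⟩ := wittFixed_natCast_dvd_pow_sub hp hq w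
  have h3 : AdjoinRoot.root D.poly ∣ AdjoinRoot.of D.poly w ^ p ^ f - AdjoinRoot.of D.poly w := by
    rw [← map_pow, ← map_sub, hc, map_mul, map_natCast]
    exact Dvd.dvd.mul_right D.root_dvd_natCast _
  have h4 : a ^ p ^ f - a = (a ^ p ^ f - AdjoinRoot.of D.poly w ^ p ^ f) +
      (AdjoinRoot.of D.poly w ^ p ^ f - AdjoinRoot.of D.poly w) - (a - AdjoinRoot.of D.poly w) := by abel
  rw [h4]
  exact dvd_sub (dvd_add h2 h3) h1

set_option maxHeartbeats 12000000 in
/-- **`𝒪_D` is `p`-torsion-free**: multiplication by `p ∈ W(k_F)` on the free `W(k_F)`-module `𝒪_D` (power basis) is injective,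
`W(k_F)` being `p`-torsion-free. [cite: SerreLocalFields1979, Ch. I §6 Prop. 18] -/
theorem isSMulRegular_coeff_natCast : IsSMulRegular D.Coeff (p : wittFixed F p) := by
  haveI : Fact (¬ IsUnit (p : maxUnramifiedCompletion F)) := ⟨not_isUnit_natCast_completion hp⟩
  haveI : CharP (ResidueField (maxUnramifiedCompletion F)) p := charP_residueField_completion
  have hp0 : (p : wittFixed F p) ≠ 0 := fun h0 =>
    WittVector.p_nonzero p (ResidueField (maxUnramifiedCompletion F))
      (by rw [← Subring.coe_natCast (wittFixed F p) p, h0, Subring.coe_zero])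
  exact (AdjoinRoot.powerBasis' D.monic).basis.isTorsionFree.isSMulRegular (IsRegular.of_ne_zero hp0)

set_option maxHeartbeats 12000000 in
/-- **`1 − p·y` is a unit of `𝒪_D`** for every `y` (`p ∈ W(k_F)` acting on the `W(k_F)`-algebra `𝒪_D`): its norm to `W(k_F)` is `≡ 1 (mod p)`, hence a unit, so multiplication
by `1 − py` is a bijection of the free `W(k_F)`-module `𝒪_D`. [cite: SerreLocalFields1979, Ch. I §6 Prop. 18] -/
theorem isUnit_one_sub_natCast_smul (y : D.Coeff) : IsUnit (1 - (p : wittFixed F p) • y) := by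
  classical
  set B := AdjoinRoot.powerBasis' (R := wittFixed F p) D.monic with hB
  haveI : Module.Finite (wittFixed F p) D.Coeff := B.finite
  haveI : Module.Free (wittFixed F p) D.Coeff := Module.Free.of_basis B.basis
  have hN : IsUnit (Algebra.norm (wittFixed F p) ((1 : D.Coeff) - (p : wittFixed F p) • y)) := by
    rw [Algebra.norm_eq_matrix_det B.basis, map_sub, map_one, map_smul]
    set M := Algebra.leftMulMatrix B.basis y with hM
    have hp0 : Ideal.Quotient.mk (Ideal.span {(p : wittFixed F p)}) (p : wittFixed F p) = 0 :=
      (Ideal.Quotient.eq_zero_iff_mem).2 (Ideal.mem_span_singleton_self _)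
    have hmap : (1 - (p : wittFixed F p) • M).map (Ideal.Quotient.mk (Ideal.span {(p : wittFixed F p)})) = 1 := by
      rw [Matrix.map_sub _ (map_sub _), Matrix.map_one _ (map_zero _) (map_one _), sub_eq_self]
      ext i j
      rw [Matrix.map_apply, Matrix.smul_apply, smul_eq_mul, map_mul, hp0, zero_mul, Matrix.zero_apply]
    have h1 : Ideal.Quotient.mk (Ideal.span {(p : wittFixed F p)}) ((1 - (p : wittFixed F p) • M).det) = 1 := by
      rw [RingHom.map_det, RingHom.mapMatrix_apply, hmap, Matrix.det_one]
    have h2 : (1 - (p : wittFixed F p) • M).det - 1 ∈ Ideal.span {(p : wittFixed F p)} := by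
      rw [← Ideal.Quotient.eq_zero_iff_mem, map_sub, h1, map_one, sub_self]
    obtain ⟨c, hc⟩ := Ideal.mem_span_singleton'.1 h2
    have h3 : (1 - (p : wittFixed F p) • M).det = 1 - (p : wittFixed F p) * (-c) := by
      rw [mul_neg, mul_comm, hc]; ring
    rw [h3]
    exact wittFixed_isUnit_one_sub_natCast_mul hp (-c)
  have hL : IsUnit (Algebra.lmul (wittFixed F p) D.Coeff ((1 : D.Coeff) - (p : wittFixed F p) • y)) :=
    (LinearMap.isUnit_iff_isUnit_det _).2 (by rw [← Algebra.norm_apply]; exact hN)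
  obtain ⟨z, hz⟩ := ((Module.End.isUnit_iff _).1 hL).2 1
  exact IsUnit.of_mul_eq_one z hz

set_option maxHeartbeats 2000000 in
/-- **`1 − ϖ^{m+1} ∈ 𝒪_D^×`** (`(1 − ϖ^n)·Σ_{i<e} ϖ^{ni} = 1 − ϖ^{ne}` and `ϖ^{ne} ∈ p𝒪_D`, `n = m + 1`).
[cite: CasselsFrohlichANT1967, Ch. VI §3.5 Remark 2] -/
theorem isUnit_one_sub_root_pow_succ (m : ℕ) : IsUnit (1 - AdjoinRoot.root D.poly ^ (m + 1)) := by
  have h1 : (1 - AdjoinRoot.root D.poly ^ (m + 1)) * ∑ i ∈ Finset.range D.deg, (AdjoinRoot.root D.poly ^ (m + 1)) ^ i =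
      1 - AdjoinRoot.root D.poly ^ (D.deg * (m + 1)) := by
    rw [mul_neg_geom_sum, ← pow_mul, mul_comm]
  have h2 : AdjoinRoot.root D.poly ^ (D.deg * (m + 1)) ∈ Ideal.span {(p : D.Coeff)} := by
    rw [pow_mul]
    exact Ideal.pow_mem_of_mem _ D.root_pow_deg_mem_span_natCast (m + 1) m.succ_pos
  obtain ⟨c, hc⟩ := Ideal.mem_span_singleton'.1 h2
  obtain ⟨u, hu⟩ := D.isUnit_one_sub_natCast_smul c
  rw [Algebra.smul_def, map_natCast] at hu
  rw [← hc, mul_comm c, ← hu] at h1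
  exact IsUnit.of_mul_eq_one ((∑ i ∈ Finset.range D.deg, (AdjoinRoot.root D.poly ^ (m + 1)) ^ i) * ↑u⁻¹)
    (by rw [← mul_assoc, h1, Units.mul_inv])

set_option maxHeartbeats 2000000 in
/-- **`ϖ` is a non-zero-divisor of `𝒪_D`**: multiplication by `ϖ` is injective (`ϖ ∣ p` and `𝒪_D` is `p`-torsion-free).
[cite: CasselsFrohlichANT1967, Ch. VI §3.5 Remark 2] -/
theorem isLeftRegular_root : IsLeftRegular (AdjoinRoot.root D.poly) := by
  intro x y hxy
  obtain ⟨c, hc⟩ := D.root_dvd_natCast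
  rw [← sub_eq_zero]
  refine D.isSMulRegular_coeff_natCast ?_
  change (p : wittFixed F p) • (x - y) = (p : wittFixed F p) • 0
  have hxy' : AdjoinRoot.root D.poly * x = AdjoinRoot.root D.poly * y := hxy
  rw [smul_zero, Algebra.smul_def, map_natCast, hc, mul_comm (AdjoinRoot.root D.poly) c, mul_assoc, mul_sub, hxy', sub_self,
    mul_zero]

/-! ## §2 `IsLTRing ϖ q_F 𝒪_D` -/

set_option maxHeartbeats 2000000 in
/-- ★ **`(𝒪_D, ϖ, q_F)` satisfies the hypotheses of Lubin–Tate's lemma** (Cassels–Fröhlich VI §3.5 Prop. 5, Remark 2): `ϖ`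
is regular, the `1 − ϖ^m` are units, `q_F = p^f` with `p ∈ ϖ𝒪_D`, and `a^{q_F} ≡ a (mod ϖ)` (`𝒪_D/ϖ = k_F = 𝔽_{q_F}`).
Hence the Lubin–Tate series of `f = ϖX + X^{q_F}` — the formal group `F_f` of `(F, ϖ)` and its endomorphisms `[a]_f`,
`a ∈ 𝒪_D` — exist with coefficients in `𝒪_D`, for EVERY finite `F/ℚ_p` (any residue degree).
[cite: CasselsFrohlichANT1967, Ch. VI §3.5 Prop. 5, Remark 2] [cite: LubinTate1965, §1 Lemma 1] -/
theorem isLTRing_coeff {f : ℕ} (hq : residueFieldCard F = p ^ f) : IsLTRing (AdjoinRoot.root D.poly) (residueFieldCard F) :=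
  ⟨fun x hx => D.isLeftRegular_root (hx.trans (mul_zero _).symm),
    fun m hm => by
      obtain ⟨k, rfl⟩ := Nat.exists_eq_succ_of_ne_zero hm.ne'
      exact D.isUnit_one_sub_root_pow_succ k,
    ⟨p, f, Fact.out, hq, Ideal.mem_span_singleton.2 D.root_dvd_natCast⟩, fun a => hq ▸ D.root_dvd_pow_sub hq a⟩

set_option maxHeartbeats 2000000 in
/-- **The same for the discrete copy `CoeffDisc D`** of `𝒪_D` (transport along `CoeffDisc.of`), the coefficient ring over which
formal series are evaluated in `A_inf(𝒪_F)` and in `𝔪_{ℂ_F}` — the hypothesis `hA` of `LubinTateAinfWittTorsionLiftAction`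
for `c = ϖ`, `q = q_F`. [cite: CasselsFrohlichANT1967, Ch. VI §3.5 Prop. 5, Remark 2] -/
theorem isLTRing_coeffDisc {f : ℕ} (hq : residueFieldCard F = p ^ f) :
    IsLTRing (CoeffDisc.of D (AdjoinRoot.root D.poly)) (residueFieldCard F) :=
  IsLTRing.of_ringEquiv (CoeffDisc.of D) (D.isLTRing_coeff hq)

end EisensteinRootW

end Literature.NumberTheory.PAdicHodge

end
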